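import Literature.Barriers.ValiantsHypothesis.GCTMatrixPoweringErratum
import Literature.RepresentationTheory.FiniteGroups.SymmetricGroupSquareEvaluation
import HarnessLib

/-!
# Gesmundo–Ikenmeyer–Panova 2017, Props. 18 and 20 as PRINTED are false: the `𝔖₅` atom
# `skTwoOneCubeVanishes` DISCHARGED by the verified Murnaghan–Nakayama evaluator

Sibling proofs file (D-0014; theorems only — no `sorry`, no definition, no new named fact) of
`GCTMatrixPoweringErratum.lean`, which isolated the erratum in GIP Props. 18 and 20
(arXiv:1611.00827 = Diff. Geom. Appl. 55 (2017), §3, held text p. 11: "Let `λ` be a partition of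
length `ℓ ≤ 14` and `λ ∉ {(1^r) : r ∈ X_s} ∪ {(2,1,1), (3,1,1), (2,1⁷)}`. Then `sm(λ, 7) > 0`") in
the single `𝔖₅` computation `skTwoOneCubeVanishes : ∀ μ ⊢ 5, skCharSum (2,1³) μ = 0`
("`sk((2,1³), μ) = 0` for all seven `μ ⊢ 5`": the hook `[2,1³] = V ⊗ sgn` occurs in no symmetric
square `S²[μ]`), vendored there as a NAMED FACT because at the time the tree had no character values
of its Specht modules, with the conditional refutations `GIP2017_prop18_false`,
`GIP2017_prop20_false : skTwoOneCubeVanishes → ¬ …`.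

The tree now has the verified evaluator of
`Literature/RepresentationTheory/FiniteGroups/SymmetricGroupSquareEvaluation.lean`:
`Σ_σ χ^λ(σ)(χ^μ(σ)² + χ^μ(σ²)) = MNEval.skSumT n λᵀ.sortedParts μ.sortedParts`
(`MNEval.sum_symSq_eq_skSumT`, Murnaghan–Nakayama on exponent vectors, Frobenius's formula and the
class equation, all proved against the tree's Young-symmetrizer Specht modules). **This file
discharges the atom**: `skTwoOneCubeVanishes_holds`, by seven kernel evaluations
`skSumT 5 [4, 1] μ = 0`, `μ ∈ {(5), (4,1), (3,2), (3,1,1), (2,2,1), (2,1³), (1⁵)}` (`(2,1³)ᵀ = (4,1)`,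
`sortedParts_transpose_twoOneCube`; the partitions of `5`, `sortedParts_eq_of_size_five`), and
records the now UNCONDITIONAL refutations `not_GIP2017_prop18 : ¬ GIP2017_prop18`,
`not_GIP2017_prop20 : ¬ GIP2017_prop20` of the two statements as printed (their corrected forms
`GIP2017_prop18_corrected`, `GIP2017_prop20_corrected` — the printed statements with `(2,1³)` added
to the exceptional list — are untouched and are what the tree's proof of GIP Thm. 10 uses,
`gctMatrixPowering_of_prop18`). For the record the skew side is positive, `ak((2,1³), (3,2)) = 1`
(`akSumT 5 [4,1] [3,2] = 2·5!`, `akSumT_twoOneCube_threeTwo`), so `am((2,1³), 3) > 0` as stated in the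
erratum docstrings.

**Verdict clean-up (2026-08-15).** On the strength of `not_GIP2017_prop18` the printed record
`GIP2017_prop18` is `@[deprecated]` in `GCTMatrixPoweringColumns.lean` (no longer a named fact of
the tree); `linter.deprecated` is switched off here for exactly the two declarations that must name
it, `not_GIP2017_prop18` and `GIP2017_prop18_iff_false`. Nothing else changed.

## References

* [GesmundoIkenmeyerPanova2017] F. Gesmundo, C. Ikenmeyer, G. Panova, *Geometric complexity theory
  and matrix powering*, Diff. Geom. Appl. 55 (2017) 106–127 = arXiv:1611.00827, §3, Props. 18, 20
  (the exceptional lists) and (3.1).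
* [FultonHarrisGTM129] W. Fulton, J. Harris, *Representation Theory. A First Course*, GTM 129
  (1991), §2.1 (characters of `Sym²`, `Λ²`), §3.1 (character table of `𝔖₅`), Examples 4.5.
* [FultonYoungTableaux1997] W. Fulton, *Young Tableaux* (1997), §0 (conjugate partition).
* [JamesKerber1981] G. James, A. Kerber, *The Representation Theory of the Symmetric Group* (1981),
  2.4.7 (Murnaghan–Nakayama).
-/

open scoped BigOperators

namespace Literature.Barriers.ValiantsHypothesis

open Literature.NumberTheory.DiophantineGeometry Literature.RepresentationTheory.FiniteGroups
  Literature.RepresentationTheory.FiniteGroups.MNEval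

/-! ### 1. The columns of `(2,1³)` and the partitions of `5` -/

/-- `(2,1³)ᵀ = (4,1)`: the columns of the hook `(2,1,1,1)` have lengths `4` and `1`.
[cite: FultonYoungTableaux1997, §0 (conjugate partition)] -/
theorem sortedParts_transpose_twoOneCube : twoOneCube.transpose.sortedParts = [4, 1] := by
  have hsup : ({2, 1, 1, 1} : Multiset ℕ).sup = 2 := by decide
  have hlen : twoOneCube.transpose.sortedParts.length = 2 := by
    rw [Nat.Partition.length_sortedParts, ← sup_parts_eq_card_transpose, twoOneCube_parts, hsup]
  have hget : ∀ r, twoOneCube.transpose.sortedParts.getD r 0 = [4, 1].getD r 0 := by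
    intro r
    rw [getD_sortedParts_eq_colCount_transpose, Nat.Partition.transpose_transpose, twoOneCube_parts]
    rcases r with _ | _ | r
    · decide
    · decide
    · rw [colCount_eq_zero_of_sup_le (by rw [hsup]; omega)]
      simp
  refine List.ext_getElem (by rw [hlen]; rfl) fun i h₁ h₂ => ?_
  have h := hget i
  rwa [List.getD_eq_getElem _ _ h₁, List.getD_eq_getElem _ _ h₂] at h

/-- **The seven partitions of `5`**, by their sorted parts. [folklore] -/
theorem sortedParts_eq_of_size_five (μ : Nat.Partition 5) :
    μ.sortedParts = [5] ∨ μ.sortedParts = [4, 1] ∨ μ.sortedParts = [3, 2] ∨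
      μ.sortedParts = [3, 1, 1] ∨ μ.sortedParts = [2, 2, 1] ∨ μ.sortedParts = [2, 1, 1, 1] ∨
        μ.sortedParts = [1, 1, 1, 1, 1] := by
  have hpos : ∀ a ∈ μ.sortedParts, 0 < a := fun a ha => μ.pos_of_mem_sortedParts ha
  have hsort : μ.sortedParts.Pairwise (· ≥ ·) :=
    List.sortedGE_iff_pairwise.mp μ.sortedGE_sortedParts
  have hsum : μ.sortedParts.sum = 5 := μ.sum_sortedParts
  generalize μ.sortedParts = L at hpos hsort hsum
  rcases L with _ | ⟨a, _ | ⟨b, _ | ⟨c, _ | ⟨d, _ | ⟨e, _ | ⟨f, t⟩⟩⟩⟩⟩⟩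
  · simp at hsum
  · simp only [List.sum_cons, List.sum_nil, add_zero] at hsum
    subst hsum
    exact Or.inl rfl
  · simp only [List.sum_cons, List.sum_nil, add_zero] at hsum
    have hab : a ≥ b := (List.pairwise_cons.1 hsort).1 b (by simp)
    have hb := hpos b (by simp)
    have h : a = 4 ∧ b = 1 ∨ a = 3 ∧ b = 2 := by omega
    rcases h with ⟨rfl, rfl⟩ | ⟨rfl, rfl⟩
    · exact Or.inr (Or.inl rfl)
    · exact Or.inr (Or.inr (Or.inl rfl))
  · simp only [List.sum_cons, List.sum_nil, add_zero] at hsum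
    obtain ⟨ha, hsort⟩ := List.pairwise_cons.1 hsort
    have hab : a ≥ b := ha b (by simp)
    have hbc : b ≥ c := (List.pairwise_cons.1 hsort).1 c (by simp)
    have hc := hpos c (by simp)
    have h : a = 3 ∧ b = 1 ∧ c = 1 ∨ a = 2 ∧ b = 2 ∧ c = 1 := by omega
    rcases h with ⟨rfl, rfl, rfl⟩ | ⟨rfl, rfl, rfl⟩
    · exact Or.inr (Or.inr (Or.inr (Or.inl rfl)))
    · exact Or.inr (Or.inr (Or.inr (Or.inr (Or.inl rfl))))
  · simp only [List.sum_cons, List.sum_nil, add_zero] at hsum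
    obtain ⟨ha, hsort⟩ := List.pairwise_cons.1 hsort
    have hab : a ≥ b := ha b (by simp)
    obtain ⟨hb, hsort⟩ := List.pairwise_cons.1 hsort
    have hbc : b ≥ c := hb c (by simp)
    have hcd : c ≥ d := (List.pairwise_cons.1 hsort).1 d (by simp)
    have hd := hpos d (by simp)
    have h : a = 2 ∧ b = 1 ∧ c = 1 ∧ d = 1 := by omega
    rcases h with ⟨rfl, rfl, rfl, rfl⟩
    exact Or.inr (Or.inr (Or.inr (Or.inr (Or.inr (Or.inl rfl)))))
  · simp only [List.sum_cons, List.sum_nil, add_zero] at hsum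
    have ha := hpos a (by simp)
    have hb := hpos b (by simp)
    have hc := hpos c (by simp)
    have hd := hpos d (by simp)
    have he := hpos e (by simp)
    have h : a = 1 ∧ b = 1 ∧ c = 1 ∧ d = 1 ∧ e = 1 := by omega
    rcases h with ⟨rfl, rfl, rfl, rfl, rfl⟩
    exact Or.inr (Or.inr (Or.inr (Or.inr (Or.inr (Or.inr rfl)))))
  · simp only [List.sum_cons] at hsum
    have ha := hpos a (by simp)
    have hb := hpos b (by simp)
    have hc := hpos c (by simp)
    have hd := hpos d (by simp)
    have he := hpos e (by simp)
    have hf := hpos f (by simp)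
    omega

/-! ### 2. The seven kernel evaluations -/

/-- **`sk((2,1³), μ) = 0` for every `μ ⊢ 5`, in the kernel**: the symmetric-square character sum
`skSumT 5 [4,1] μ = Σ_σ χ^{(2,1³)}(σ)(χ^μ(σ)² + χ^μ(σ²)) = 2·5!·sk((2,1³), μ)` of the verified
evaluator vanishes on each of the seven sorted part lists of the partitions of `5`.
[cite: FultonHarrisGTM129, §3.1 (character table of 𝔖₅) and §2.1] -/
theorem skSumT_twoOneCube_eq_zero {M : List ℕ}
    (hM : M = [5] ∨ M = [4, 1] ∨ M = [3, 2] ∨ M = [3, 1, 1] ∨ M = [2, 2, 1] ∨ M = [2, 1, 1, 1] ∨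
      M = [1, 1, 1, 1, 1]) :
    skSumT 5 [4, 1] M = 0 := by
  rcases hM with rfl | rfl | rfl | rfl | rfl | rfl | rfl <;> decide

/-- The skew side is positive: `akSumT 5 [4,1] [3,2] = 2·5!·ak((2,1³), (3,2)) = 240`, i.e.
`ak((2,1³), (3,2)) = 1` (so `am((2,1³), 3) > 0`, as recorded in the erratum).
[cite: FultonHarrisGTM129, §3.1 (character table of 𝔖₅) and §2.1] -/
theorem akSumT_twoOneCube_threeTwo : akSumT 5 [4, 1] [3, 2] = 2 * Nat.factorial 5 := by
  decide

/-! ### 3. The discharge and the unconditional refutations -/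

/-- **The `𝔖₅` atom of the erratum, DISCHARGED**: `skCharSum (2,1³) μ = 0` for every `μ ⊢ 5`
(`sk((2,1³), μ) = 0`: the irreducible `[2,1³]` of `𝔖₅` occurs in no symmetric square `S²[μ]`), by
the class equation `sum_symSq_eq_skSumT` of the verified Murnaghan–Nakayama evaluator and seven
kernel evaluations. [cite: FultonHarrisGTM129, §3.1 (character table of 𝔖₅, Ex. 3.2, Ex. 3.3) and Examples 4.5] [cite: JamesKerber1981, 2.4.7] -/
theorem skTwoOneCubeVanishes_holds : skTwoOneCubeVanishes := by
  intro μ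
  rw [skCharSum, sum_symSq_eq_skSumT, sortedParts_transpose_twoOneCube,
    skSumT_twoOneCube_eq_zero (sortedParts_eq_of_size_five μ), Int.cast_zero]

/-- `sm((2,1³), a) = 0` for every number of rows `a`, unconditionally.
[cite: FultonHarrisGTM129, §3.1 (character table of 𝔖₅)] -/
theorem not_smPos_twoOneCube' (a : ℕ) : ¬ SmPos a twoOneCube :=
  not_smPos_twoOneCube skTwoOneCubeVanishes_holds a

-- `linter.deprecated` is switched off for the next declaration only: this IS the refutation of the
-- record `GIP2017_prop18` of `GCTMatrixPoweringColumns.lean` (deprecated there since the verdict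
-- clean-up of 2026-08-15 precisely because of this theorem) and must name it. REMOVE-WHEN the
-- record is deleted.
set_option linter.deprecated false in
/-- **GIP Prop. 18 as printed is FALSE** (unconditionally): the hook `(2,1³) ⊢ 5` has length
`4 ≤ 14`, is not in the printed exceptional list, and `sm((2,1³), 7) = 0`. This is the refuting
theorem the deprecated record `GIP2017_prop18` points to; the corrected statement is
`GIP2017_prop18_corrected`, proved as `GIP2017_prop18_corrected_holds`
(`GCTMatrixPoweringProp20Holds.lean`).
[cite: GesmundoIkenmeyerPanova2017, Prop. 18] [cite: FultonHarrisGTM129, §3.1] -/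
theorem not_GIP2017_prop18 : ¬ GIP2017_prop18 :=
  GIP2017_prop18_false skTwoOneCubeVanishes_holds

/-- **GIP Prop. 20 as printed is FALSE** (unconditionally): `(2,1³)` (length `4`, not listed, not
of the form `(2,2,1^k)`) has `sm((2,1³), 12) = 0`. [cite: GesmundoIkenmeyerPanova2017, Prop. 20] [cite: FultonHarrisGTM129, §3.1] -/
theorem not_GIP2017_prop20 : ¬ GIP2017_prop20 :=
  GIP2017_prop20_false skTwoOneCubeVanishes_holds

-- `linter.deprecated` off for the next declaration only: it restates the refutation of the
-- deprecated record `GIP2017_prop18` as an `iff` and must name it. REMOVE-WHEN the record is deleted.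
set_option linter.deprecated false in
/-- The printed Prop. 18 is equivalent to `False`; its content survives as
`GIP2017_prop18_corrected` (`GIP2017_prop18_iff`). [cite: GesmundoIkenmeyerPanova2017, Prop. 18] -/
theorem GIP2017_prop18_iff_false : GIP2017_prop18 ↔ False :=
  ⟨not_GIP2017_prop18, False.elim⟩

/-- The printed Prop. 20 is equivalent to `False`; its content survives as
`GIP2017_prop20_corrected` (`GIP2017_prop20_iff`). [cite: GesmundoIkenmeyerPanova2017, Prop. 20] -/
theorem GIP2017_prop20_iff_false' : GIP2017_prop20 ↔ False :=
  GIP2017_prop20_iff_false skTwoOneCubeVanishes_holds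

/-- **The corrected Prop. 18 is exactly what is left**: `GIP2017_prop18_corrected` is equivalent to
the printed statement restricted to `λ ≠ (2,1³)` — the printed statement being the corrected one
plus the false atom `sm((2,1³), 7) > 0` (`GIP2017_prop18_iff`).
[cite: GesmundoIkenmeyerPanova2017, Prop. 18] -/
theorem GIP2017_prop18_corrected_iff :
    GIP2017_prop18_corrected ↔
      ∀ (D : ℕ) (lam : Nat.Partition D), lam.parts.card ≤ 14 → lam.parts ∉ gipExceptionalShapes →
        lam.parts ≠ {2, 1, 1, 1} → SmPos 7 lam := by
  constructor
  · intro h D lam hl hE hne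
    exact h D lam hl fun hmem => ((mem_gipExceptionalShapesCorrected_iff _).mp hmem).elim hne hE
  · intro h D lam hl hE
    refine h D lam hl (fun hmem => hE (mem_gipExceptionalShapesCorrected_of_mem hmem)) fun hp => ?_
    exact hE (hp ▸ (mem_gipExceptionalShapesCorrected_iff _).mpr (Or.inl rfl))

end Literature.Barriers.ValiantsHypothesis
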